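import Summits.Ventures.Crystal3D.Bulk.HullFaceSubtendedEar
import HarnessLib

/-!
# A point in the corner fan of a face sees the sides of the face under a total angle `≥ 2π` and
# satisfies the inner-path rows — the ear-insertion induction (rattler prune (d1)(d2),
# `DESIGN-L12-THEORY` §P-L3 (d), T2 §14 "the sides of `F` subtend `≥ 360°` at `z`" and §14.3)

HONEST FRAMING. Part of the venture `Summits/Ventures/Crystal3D` (cell `pub-crystal3d`, phase 2;
seat p3), generic and configuration-free (`X` any finite set of unit vectors of `ℝ³` with `0`
interior to its hull); nothing here mentions GAP(1.26). THE THEOREM: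

* **`HullRotSys.subtended_of_cover`** — for an `α`-closed, covering, connected sub-map `S` of the
  hull fan with all corners `< π`, a dart `d ∈ S` and a unit vector `z ∉ X` in the corner fan of
  the face of `d` (`InCornerFan`, `Bulk/HullFaceSubtended.lean`): `2π ≤ subtSum S d z` (the sides
  wind at least once around `z`) and `SidesFar S d z` (`∠(z,v_t) + ∠(z,v_{t+1}) + ∠(v_t,v_{t+1})
  ≤ perimeter` for every side).

Proof (`subtended_aux`) = induction on the number of hull darts outside `S`, with the bricks of
`Bulk/HullFaceSubtendedEar.lean`: whole fan ⇒ `subtended_univ`; otherwise insert the diagonal of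
an ear (`exists_long_face_of_ne_univ`, `exists_ear_of_cover`; corners shrink, cover and
connectivity persist); faces off the ear keep walk and corner fan; on the face of the ear,
`inCornerFan_ear_cases` puts `z` in the ear triangle (then `triangle_rows_of_mem_cone` and the
chain inequality along the rest of the walk) or in the corner fan of the shortened face (then the
induction hypothesis, glued back along the diagonal by the trihedral / triangle inequalities) —
`sum_walk_ear_split` does the bookkeeping of the two walks.
-/

noncomputable section

namespace Summit.Ventures.Crystal3D

namespace HullRotSys

open Literature.Geometry.DiscreteGeometry Finset Equiv Real InnerProductGeometry Function
open scoped InnerProductSpace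

variable {X : Finset (EuclideanSpace ℝ (Fin 3))} {hX1 : ∀ y ∈ X, ‖y‖ = 1}
  {h0 : (0 : EuclideanSpace ℝ (Fin 3)) ∈ interior (convexHull ℝ (X : Set _))}

/-! ## Bookkeeping of the two walks -/

/-- Chain inequality, weak form: `∠(f i, f j) ≤ Σ_{t ∈ [i,j)} ∠(f t, f (t+1))` for `i ≤ j`, provided
`f i ≠ 0` (so that the empty case `i = j` reads `0 ≤ 0`). -/
theorem angle_le_sum_angle_of_le (f : ℕ → EuclideanSpace ℝ (Fin 3)) {i j : ℕ} (hij : i ≤ j)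
    (hi : f i ≠ 0) : angle (f i) (f j) ≤ ∑ t ∈ Ico i j, angle (f t) (f (t + 1)) := by
  rcases hij.eq_or_lt with rfl | hlt
  · rw [angle_self hi, Finset.Ico_self, Finset.sum_empty]
  · exact angle_le_sum_angle f hlt

/-- Rearranging a walk sum after an ear is cut off: with `v` the walk of the ear's face (period
`m`, `v m = v 0`) and `u` the walk of the shortened face (`u 0 = v 0`, `u k = v (k+1)` for
`1 ≤ k ≤ m − 2`, `u (m−1) = v 0`), for any weight `F` on consecutive pairs. -/
theorem sum_walk_ear_split {m : ℕ} (hm : 4 ≤ m) (v u : ℕ → EuclideanSpace ℝ (Fin 3))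
    (hvm : v m = v 0) (hu0 : u 0 = v 0) (huk : ∀ k, 1 ≤ k → k + 2 ≤ m → u k = v (k + 1))
    (hum : u (m - 1) = v 0) (F : EuclideanSpace ℝ (Fin 3) → EuclideanSpace ℝ (Fin 3) → ℝ) :
    (∑ t ∈ range m, F (v t) (v (t + 1))) =
        F (v 0) (v 1) + F (v 1) (v 2) + ∑ t ∈ Ico 2 m, F (v t) (v (t + 1)) ∧
      (∑ k ∈ range (m - 1), F (u k) (u (k + 1))) =
        F (v 0) (v 2) + ∑ t ∈ Ico 2 m, F (v t) (v (t + 1)) := by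
  constructor
  · rw [Finset.range_eq_Ico, Finset.sum_eq_sum_Ico_succ_bot (by omega),
      Finset.sum_eq_sum_Ico_succ_bot (by omega)]
    simp only [zero_add, Nat.reduceAdd, add_assoc]
  · rw [Finset.range_eq_Ico, Finset.sum_eq_sum_Ico_succ_bot (by omega), hu0,
      huk 1 le_rfl (by omega)]
    congr 1
    rw [show (2 : ℕ) = 1 + 1 from rfl, show m = (m - 1) + 1 by omega, ← Finset.sum_Ico_add']
    rw [show m - 1 + 1 - 1 = m - 1 by omega]
    refine Finset.sum_congr rfl fun k hk => ?_
    rw [Finset.mem_Ico] at hk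
    rw [huk k hk.1 (by omega)]
    rcases Nat.lt_or_ge (k + 1) (m - 1) with h | h
    · rw [huk (k + 1) (by omega) (by omega)]
    · rw [show k + 1 = m - 1 by omega, hum, show m - 1 + 1 = m by omega, hvm]

/-! ## The induction -/

/-- **The induction** (on the number of hull darts outside `S`). -/
theorem subtended_aux :
    ∀ (N : ℕ) (S : Finset ↥(hullDarts X)), (univ \ S).card = N → RotSys.IsClosed (inv X) S →
      (∀ y ∈ X, ∃ z ∈ S, z.1.1 = y) → RotSys.numK (rot hX1 h0) (inv X) S = 1 →
      (∀ z ∈ S, RotSys.cornerAt (rot hX1 h0) (dartWeight X) S z < π) →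
      ∀ d ∈ S, ∀ z : EuclideanSpace ℝ (Fin 3), ‖z‖ = 1 → z ∉ X → InCornerFan hX1 h0 S d z →
        2 * π ≤ subtSum hX1 h0 S d z ∧ SidesFar hX1 h0 S d z := by
  intro N
  induction N using Nat.strong_induction_on with
  | _ N ih =>
  intro S hN hS hcov hk hlt d hd z hz1 hzX hfan
  have hrs : RotSys.IsRotSys (rot hX1 h0) (inv X) := isRotSys
  -- the whole fan: base case
  by_cases huniv : S = univ
  · subst huniv; exact subtended_univ hz1 hzX hfan
  -- otherwise a long face, hence an ear `e`
  obtain ⟨d₀, hd₀, h4⟩ := exists_long_face_of_ne_univ hS hcov hk hlt huniv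
  obtain ⟨e, he, hm4, hear⟩ := exists_ear_of_cover hS hcov hk ⟨d₀, hd₀, h4⟩
  set φ := RotSys.phi (rot hX1 h0) (inv X) S with hφ
  set m := facePeriod hX1 h0 S e with hmdef
  have hme : minimalPeriod φ e = m := rfl
  set f1 := φ e with hf1
  set g := rot hX1 h0 (inv X f1) with hgdef
  have htri : rot hX1 h0 (inv X g) = e := by
    rw [hgdef, hear]; exact rot_inv_rot_inv_rot_inv e
  -- `g ∉ S`, else the face of `e` would be the triangle
  have hgS : g ∉ S := by
    intro hgS
    have hf1S : f1 ∈ S := RotSys.phi_apply_mem hS he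
    have h1 : φ f1 = g := by
      rw [hφ, RotSys.phi_apply]
      exact RotSys.induce_eq_of_first_return _ (hS _ hf1S) Nat.one_pos (by rw [pow_one])
        hgS (fun m hm0 hm1 => absurd hm1 (by omega))
    have h2 : φ g = e := by
      rw [hφ, RotSys.phi_apply]
      exact RotSys.induce_eq_of_first_return _ (hS _ hgS) Nat.one_pos (by rw [pow_one]; exact htri)
        he (fun m hm0 hm1 => absurd hm1 (by omega))
    have h3 : (φ ^ 3) e = e := by
      rw [pow_succ, pow_two, Perm.mul_apply, Perm.mul_apply, ← hf1, h1, h2]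
    have hper : IsPeriodicPt φ 3 e := by
      rw [IsPeriodicPt, IsFixedPt, ← RotSys.pow_apply_eq_iterate]; exact h3
    have := hper.minimalPeriod_le (by norm_num)
    rw [hme] at this
    omega
  -- the enlarged map
  set S' := S ∪ {g, inv X g} with hS'def
  have hsub : S ⊆ S' := subset_union_left
  have hS'c : RotSys.IsClosed (inv X) S' := RotSys.isClosed_union_ear hrs hS
  have hαgS : inv X g ∉ S := RotSys.alpha_g_not_mem hrs hS hgS
  have hgS' : g ∈ S' := mem_union_right _ (mem_insert_self _ _)
  have hαgS' : inv X g ∈ S' := mem_union_right _ (mem_insert_of_mem (mem_singleton_self _))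
  have hN' : (univ \ S').card < N := by
    have hlt' : (univ \ S').card < (univ \ S).card := by
      apply Finset.card_lt_card
      refine ⟨sdiff_subset_sdiff Subset.rfl hsub, fun hle => ?_⟩
      have : g ∈ univ \ S := mem_sdiff.2 ⟨mem_univ _, hgS⟩
      have := hle this
      rw [mem_sdiff] at this
      exact this.2 hgS'
    rw [hN] at hlt'; exact hlt'
  have hcov' : ∀ y ∈ X, ∃ z ∈ S', z.1.1 = y := fun y hy => by
    obtain ⟨w, hw, hwy⟩ := hcov y hy; exact ⟨w, hsub hw, hwy⟩
  have hk' : RotSys.numK (rot hX1 h0) (inv X) S' = 1 := numK_eq_one_of_cover hsub hcov hk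
  -- the splice facts
  set φ' := RotSys.phi (rot hX1 h0) (inv X) S' with hφ'
  have hφ'f1 : φ' f1 = g := RotSys.phi_union_ear_f1 hS he
  have hφ'αg : φ' (inv X g) = (φ ^ 2) e := RotSys.phi_union_ear_alpha_g hrs hS he hgS
  have hφ'g : φ' g = e := RotSys.phi_union_ear_g he htri
  have hφ'last : φ' ((φ ^ (m - 1)) e) = inv X g :=
    RotSys.phi_union_ear_last hrs hS he htri hgS (by rw [hme]; omega)
  -- all corners of `S'` are `< π`
  have hlt' : ∀ z ∈ S', RotSys.cornerAt (rot hX1 h0) (dartWeight X) S' z < π := by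
    intro x hx
    rw [hS'def, mem_union, mem_insert, mem_singleton] at hx
    rcases hx with hx | rfl | rfl
    · exact (cornerAt_mono hsub hx).trans_lt (hlt x hx)
    · have hx : inv X f1 ∈ S := hS _ (RotSys.phi_apply_mem hS he)
      have hind : RotSys.induce (rot hX1 h0) S' (inv X f1) = g :=
        RotSys.induce_eq_of_first_return _ (hsub hx) Nat.one_pos (by rw [pow_one]) hgS'
          (fun m hm0 hm1 => absurd hm1 (by omega))
      have hind2 : RotSys.induce (rot hX1 h0) S' g ∈ S := by
        have : RotSys.induce (rot hX1 h0) S' g = φ' (inv X g) := by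
          rw [hφ', RotSys.phi_apply, hrs.α_inv]
        rw [this, hφ'αg]
        exact RotSys.phi_pow_apply_mem hS he 2
      have hsplit := RotSys.cornerAt_subset_of_not_mem (rot hX1 h0) (dartWeight X) hsub hx
        (by rw [hind]; exact hgS) (by rw [hind]; exact hind2)
      rw [hind] at hsplit
      have := hlt _ hx
      have h0' := cornerAt_nonneg (hX1 := hX1) (h0 := h0) S' (inv X f1)
      linarith
    · have hx : inv X ((φ ^ (m - 1)) e) ∈ S := hS _ (RotSys.phi_pow_apply_mem hS he (m - 1))
      have hind : RotSys.induce (rot hX1 h0) S' (inv X ((φ ^ (m - 1)) e)) = inv X g := by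
        rw [← RotSys.phi_apply]; exact hφ'last
      have hind2 : RotSys.induce (rot hX1 h0) S' (inv X g) ∈ S := by
        have : RotSys.induce (rot hX1 h0) S' (inv X g) = φ' g := by rw [hφ', RotSys.phi_apply]
        rw [this, hφ'g]; exact he
      have hsplit := RotSys.cornerAt_subset_of_not_mem (rot hX1 h0) (dartWeight X) hsub hx
        (by rw [hind]; exact hαgS) (by rw [hind]; exact hind2)
      rw [hind] at hsplit
      have := hlt _ hx
      have h0' := cornerAt_nonneg (hX1 := hX1) (h0 := h0) S' (inv X ((φ ^ (m - 1)) e))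
      linarith
  -- the induction hypothesis on `S'`
  have hIH : ∀ x ∈ S', ∀ w : EuclideanSpace ℝ (Fin 3), ‖w‖ = 1 → w ∉ X →
      InCornerFan hX1 h0 S' x w → 2 * π ≤ subtSum hX1 h0 S' x w ∧ SidesFar hX1 h0 S' x w :=
    ih _ hN' S' rfl hS'c hcov' hk' hlt'
  -- CASE B: `d` is not on the face of the ear — walk and corner fan are untouched
  by_cases hsame : ¬ φ.SameCycle e d
  · have heq : ∀ t, φ' (faceDart hX1 h0 S d t) = φ (faceDart hX1 h0 S d t) := by
      intro t
      set x := faceDart hX1 h0 S d t with hxdef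
      have hxS : x ∈ S := faceDart_mem hS hd t
      have hxd : φ.SameCycle d x := ⟨(t : ℤ), by rw [zpow_natCast]; rfl⟩
      have key := RotSys.phi_eq_splice hrs hS hgS hxS
      rw [← hgdef, ← hS'def, ← hφ, ← hφ'] at key
      have hne1 : φ' x ≠ g := by
        intro heq
        rw [← hφ'f1] at heq
        have hxf1 : x = f1 := φ'.injective heq
        apply hsame
        have h1 : φ.SameCycle e f1 := ⟨1, by rw [zpow_one]⟩
        exact h1.trans (hxf1 ▸ hxd.symm)
      have hne2 : φ' x ≠ inv X g := by
        intro heq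
        rw [if_neg hne1, if_pos heq, hφ'g] at key
        apply hsame
        have h1 : φ.SameCycle x e := ⟨1, by rw [zpow_one, key]⟩
        exact (hxd.trans h1).symm
      rw [if_neg hne1, if_neg hne2] at key
      exact key.symm
    have hfan' : InCornerFan hX1 h0 S' d z := inCornerFan_of_forall_phi_eq hsub hS hd heq hfan
    obtain ⟨hP, hQ⟩ := hIH d (hsub hd) z hz1 hzX hfan'
    refine ⟨?_, sidesFar_of_forall_phi_eq heq hQ⟩
    rw [← subtSum_eq_of_forall_phi_eq heq z]; exact hP
  -- CASE A: `d` is on the face of the ear; work with the walk of `e` and shift at the end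
  rw [not_not] at hsame
  obtain ⟨r, hrm, hr⟩ := RotSys.SameCycle.exists_lt_minimalPeriod hsame
  have hdr : d = faceDart hX1 h0 S e r := by unfold faceDart; rw [← hφ, hr]
  have hfan_e : InCornerFan hX1 h0 S e z := InCornerFan.of_shift r (hdr ▸ hfan)
  -- it suffices to treat `e`
  suffices hmain : 2 * π ≤ subtSum hX1 h0 S e z ∧ SidesFar hX1 h0 S e z by
    rw [hdr, subtSum_shift]
    refine ⟨hmain.1, SidesFar.of_shift (m - r) ?_⟩
    have hback : faceDart hX1 h0 S (faceDart hX1 h0 S e r) (m - r) = e := by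
      rw [faceDart_shift, Nat.sub_add_cancel (by rw [← hme]; exact hrm.le), hmdef,
        ← zero_add (facePeriod hX1 h0 S e), faceDart_add_period, faceDart_zero]
    rw [hback]; exact hmain.2
  -- the two walks
  set v := faceVertex hX1 h0 S e with hvdef
  set u := faceVertex hX1 h0 S' (inv X g) with hudef
  have hper' : facePeriod hX1 h0 S' (inv X g) = m - 1 :=
    RotSys.minimalPeriod_phi_union_ear hrs hS he htri hgS (by rw [hme]; omega)
  have hvm : v m = v 0 := by
    have := faceVertex_add_period (hX1 := hX1) (h0 := h0) S e 0
    rw [zero_add] at this; exact this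
  have hu0 : u 0 = v 0 := by
    rw [hudef, hvdef]
    unfold faceVertex
    rw [faceDart_zero, faceDart_zero, inv_apply_val, Prod.fst_swap]
    have : (rot hX1 h0 (inv X g)).1.1 = (inv X g).1.1 := by
      have := rot_pow_apply_fst (hX1 := hX1) (h0 := h0) 1 (inv X g)
      rwa [pow_one] at this
    rw [inv_apply_val, Prod.fst_swap] at this
    rw [← this, htri]
  have huk : ∀ k, 1 ≤ k → k + 2 ≤ m → u k = v (k + 1) := by
    intro k hk1 hk
    rw [hudef, hvdef]
    unfold faceVertex faceDart
    rw [RotSys.pow_phi_union_ear_alpha_g hrs hS he htri hgS hk1 (by rw [hme]; omega)]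
  have hum : u (m - 1) = v 0 := by
    have := faceVertex_add_period (hX1 := hX1) (h0 := h0) S' (inv X g) 0
    rw [hper', zero_add] at this
    change faceVertex hX1 h0 S' (inv X g) (m - 1) = v 0
    rw [this]; exact hu0
  -- unit vertices, the honest ear triangle
  have hvX : ∀ t, v t ∈ X := fun t => fst_mem_of_mem_hullDarts hX1 (faceDart hX1 h0 S e t).2
  have hv1 : ∀ t, ‖v t‖ = 1 := fun t => hX1 _ (hvX t)
  have hvz : ∀ t, v t ≠ z := fun t heq => hzX (heq ▸ hvX t)
  have hv0' : ∀ t, v t ≠ 0 := fun t heq => by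
    have := hv1 t; rw [heq, norm_zero] at this; exact zero_ne_one this
  have hor : orient3 (v 0) (v 1) (v 2) ≠ 0 := by
    have := orient3_walk_pos hS hlt he 0
    rw [zero_add, orient3_swap_left] at this
    intro h0'; rw [h0', neg_zero] at this; exact lt_irrefl _ this
  -- splitting the four sums along the ear
  set W : EuclideanSpace ℝ (Fin 3) → EuclideanSpace ℝ (Fin 3) → ℝ :=
    fun a b => angle (perpTo z a) (perpTo z b) with hW
  set L : EuclideanSpace ℝ (Fin 3) → EuclideanSpace ℝ (Fin 3) → ℝ := fun a b => angle a b with hL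
  obtain ⟨hWv, hWu⟩ := sum_walk_ear_split hm4 v u hvm hu0 huk hum W
  obtain ⟨hLv, hLu⟩ := sum_walk_ear_split hm4 v u hvm hu0 huk hum L
  set RW := ∑ t ∈ Ico 2 m, W (v t) (v (t + 1)) with hRW
  set RL := ∑ t ∈ Ico 2 m, L (v t) (v (t + 1)) with hRL
  have hsubS : subtSum hX1 h0 S e z = W (v 0) (v 1) + W (v 1) (v 2) + RW := by
    unfold subtSum; exact hWv
  have hsubS' : subtSum hX1 h0 S' (inv X g) z = W (v 0) (v 2) + RW := by
    unfold subtSum; rw [hper']; exact hWu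
  have hperS : perim hX1 h0 S e = L (v 0) (v 1) + L (v 1) (v 2) + RL := by
    unfold perim; exact hLv
  have hperS' : perim hX1 h0 S' (inv X g) = L (v 0) (v 2) + RL := by
    unfold perim; rw [hper']; exact hLu
  -- chain inequalities along the rest of the walk `v₂ → … → v_m = v₀`
  have hm2 : 2 < m := by omega
  have hchW : W (v 2) (v 0) ≤ RW := by
    have := angle_le_sum_angle (fun t => perpTo z (v t)) hm2
    try dsimp only at this
    rw [hvm] at this; exact this
  have hchL : L (v 2) (v 0) ≤ RL := by
    have := angle_le_sum_angle v hm2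
    rw [hvm] at this; exact this
  -- W and L unfolded, symmetric
  have hWs : ∀ a b, W a b = W b a := fun a b => angle_comm _ _
  have hLs : ∀ a b, L a b = L b a := fun a b => angle_comm _ _
  have hLtri : ∀ a b c : EuclideanSpace ℝ (Fin 3), L a c ≤ L a b + L b c :=
    fun a b c => angle_le_angle_add_angle a b c
  have hWtri : W (v 0) (v 2) ≤ W (v 0) (v 1) + W (v 1) (v 2) := angle_le_angle_add_angle _ _ _
  -- where is `z`?
  have hcases : (∃ a b c : ℝ, 0 ≤ a ∧ 0 ≤ b ∧ 0 ≤ c ∧ z = a • v 0 + b • v 1 + c • v 2) ∨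
      InCornerFan hX1 h0 S' (inv X g) z :=
    inCornerFan_ear_cases hS he hear hm4 hgS hfan_e
  rcases hcases with ⟨a, b, c, ha, hb, hc, hzT⟩ | hfan'
  · -- `z` in the ear triangle
    obtain ⟨hwind, hI1, hI2, hI3⟩ := triangle_rows_of_mem_cone hz1 (hv1 0) (hv1 1) (hv1 2)
      (hvz 0) (hvz 1) (hvz 2) hor ha hb hc hzT
    refine ⟨?_, ?_⟩
    · rw [hsubS]
      have e1 : W (v 0) (v 1) + W (v 1) (v 2) + W (v 2) (v 0) =
          angle (perpTo z (v 0)) (perpTo z (v 1)) + angle (perpTo z (v 1)) (perpTo z (v 2)) +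
            angle (perpTo z (v 2)) (perpTo z (v 0)) := rfl
      linarith
    · intro t ht
      rw [hperS]
      change L z (v t) + L z (v (t + 1)) + L (v t) (v (t + 1)) ≤ _
      have hI1' : L z (v 0) + L z (v 1) ≤ L (v 2) (v 0) + L (v 2) (v 1) := hI1
      have hI2' : L z (v 1) + L z (v 2) ≤ L (v 0) (v 1) + L (v 0) (v 2) := hI2
      have hI3' : L z (v 2) + L z (v 0) ≤ L (v 1) (v 2) + L (v 1) (v 0) := hI3
      have ht' : t < m := ht
      by_cases ht0 : t = 0
      · subst ht0
        rw [zero_add]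
        linarith [hLs (v 2) (v 1)]
      by_cases ht1 : t = 1
      · subst ht1
        rw [show (1 : ℕ) + 1 = 2 from rfl]
        linarith [hLs (v 0) (v 2)]
      · -- `2 ≤ t < m`: go from `v_t` back to `v₂` and from `v_{t+1}` forward to `v_m = v₀`
        have ht2 : 2 ≤ t := by omega
        have hsplit : RL = (∑ s ∈ Ico 2 t, L (v s) (v (s + 1))) + L (v t) (v (t + 1)) +
            ∑ s ∈ Ico (t + 1) m, L (v s) (v (s + 1)) := by
          rw [hRL, ← Finset.sum_Ico_consecutive _ ht2 ht'.le, Finset.sum_eq_sum_Ico_succ_bot ht',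
            add_assoc]
        have hb1 : L (v 2) (v t) ≤ ∑ s ∈ Ico 2 t, L (v s) (v (s + 1)) :=
          angle_le_sum_angle_of_le v ht2 (hv0' 2)
        have hb2 : L (v (t + 1)) (v m) ≤ ∑ s ∈ Ico (t + 1) m, L (v s) (v (s + 1)) :=
          angle_le_sum_angle_of_le v (by omega) (hv0' (t + 1))
        rw [hvm] at hb2
        have h1 := hLtri z (v 2) (v t)
        have h2 := hLtri z (v 0) (v (t + 1))
        rw [hLs (v 0) (v (t + 1))] at h2
        linarith [hLs (v 1) (v 0)]
  · -- `z` in the corner fan of the shortened face: induction hypothesis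
    obtain ⟨hP', hQ'⟩ := hIH (inv X g) hαgS' z hz1 hzX hfan'
    refine ⟨?_, ?_⟩
    · rw [hsubS]; rw [hsubS'] at hP'; linarith
    · intro t ht
      rw [hperS]
      change L z (v t) + L z (v (t + 1)) + L (v t) (v (t + 1)) ≤ _
      have ht' : t < m := ht
      have hQ'' : ∀ k, k < m - 1 → L z (u k) + L z (u (k + 1)) + L (u k) (u (k + 1)) ≤
          L (v 0) (v 2) + RL := by
        intro k hk
        have := hQ' k (by rw [hper']; exact hk)
        rw [hperS'] at this; exact this
      by_cases ht0 : t = 0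
      · subst ht0
        have h := hQ'' 0 (by omega)
        rw [zero_add, hu0, huk 1 le_rfl (by omega)] at h
        rw [zero_add]
        have h1 := hLtri z (v 2) (v 1)
        linarith [hLs (v 2) (v 1)]
      by_cases ht1 : t = 1
      · subst ht1
        have h := hQ'' 0 (by omega)
        rw [zero_add, hu0, huk 1 le_rfl (by omega)] at h
        rw [show (1 : ℕ) + 1 = 2 from rfl]
        have h1 := hLtri z (v 0) (v 1)
        linarith
      · have ht2 : 2 ≤ t := by omega
        have h := hQ'' (t - 1) (by omega)
        rw [show t - 1 + 1 = t by omega, huk (t - 1) (by omega) (by omega),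
          show t - 1 + 1 = t by omega] at h
        have hut : u t = v (t + 1) := by
          rcases Nat.lt_or_ge t (m - 1) with hlt | hge
          · exact huk t (by omega) (by omega)
          · rw [show t = m - 1 by omega, hum, show m - 1 + 1 = m by omega, hvm]
        rw [hut] at h
        have h1 := hLtri (v 0) (v 1) (v 2)
        linarith

/-- **Winding and inner-path rows for a point in the corner fan of a face.** For an `α`-closed,
covering, connected sub-map `S` of the hull fan with all corners `< π`, a dart `d ∈ S` and a
unit vector `z ∉ X` in the corner fan of the face of `d`: the sides of the face subtend a total
angle `≥ 2π` at `z`, and every side satisfies `∠(z,v_t) + ∠(z,v_{t+1}) + ∠(v_t,v_{t+1}) ≤ perim`. -/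
theorem subtended_of_cover {S : Finset ↥(hullDarts X)} (hS : RotSys.IsClosed (inv X) S)
    (hcov : ∀ y ∈ X, ∃ z ∈ S, z.1.1 = y) (hk : RotSys.numK (rot hX1 h0) (inv X) S = 1)
    (hlt : ∀ z ∈ S, RotSys.cornerAt (rot hX1 h0) (dartWeight X) S z < π)
    {d : ↥(hullDarts X)} (hd : d ∈ S) {z : EuclideanSpace ℝ (Fin 3)} (hz1 : ‖z‖ = 1)
    (hzX : z ∉ X) (hfan : InCornerFan hX1 h0 S d z) :
    2 * π ≤ subtSum hX1 h0 S d z ∧ SidesFar hX1 h0 S d z :=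
  subtended_aux _ S rfl hS hcov hk hlt d hd z hz1 hzX hfan

end HullRotSys

end Summit.Ventures.Crystal3D
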